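import Literature.MathematicalPhysics.QuantumFieldTheory.Balaban1983to89.B1Cor23DerivRegularRegion

/-!
# `Balaban1983to89.B1DeltaGRegularRegion` — [Balaban1983RegularityDecay] **(1.11) / Cor. 2.3 (2.30) second sentence: the `L²` pairing of the
# DIFFERENCE `δG_k(Ω,Ω₀,A) = G_k(Ω,A) − G_k(Ω₀,A)`, `Ω ⊂ Ω₀`, AT A REGULAR `A` FOR NESTED REGIONS of `T_ε`** on the CONCRETE (Higgs)₂,₃ carrier
# (`HiggsCovariance.propagatorK`): the CUTOFF–COMMUTATOR ENGINE (covariant Leibniz rule for a scalar cutoff, the exact first-order commutator identity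
# for the Neumann forms, the `P_k(A)`-commutator bound by the block oscillation, restricted-norm decay by duality from r14 g14's pairings) —
# the four INPUTS — and (v1.1, §5) THE ASSEMBLED BOUND `|⟨f, δG^ε_k(Ω,Ω₀,A)f′⟩| ≤ C·(L^kε)²e^{−δr/L^k}e^{−δr′/L^k}‖f‖‖f′‖` for every cutoff
# `χ` adapted to `(Ω, Ω₀)`, `r, r′` the separations of `supp f`, `supp f′` from the cutoff's transition set (theorems only; the construction of an
# adapted cutoff with `κ = 1/(ML^k)` and the printed quantifier shape remain the successor's step, `lit-balaban-r14/DESIGN-deltaG-pairings.md`)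

statement-level skeleton of published theorems with citation tags; proofs where landed; nothing here is a claim about the Yang–Mills mass gap

PDF held: `paper:balaban1983-cmp89-regularity-decay` p. 573 [PDF 3] ((1.11)–(1.12) `δG_k(Ω,Ω₀,A) = G_k(Ω,A) − G_k(Ω₀,A)`), p. 580 [PDF 10] (Cor. 2.3,
second sentence); [Balaban1982Higgs1] = `paper:balaban1982-cmp85-higgs23-i` p. 605 (1.7), p. 610 (2.20)–(2.23).

CITATION HEADER (lean-in-tree rule).  T. Bałaban, *Regularity and decay of lattice Green's functions*, Commun. Math. Phys. **89** (1983) 571–597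
[Balaban1983RegularityDecay], (1.11) p. 573, Cor. 2.3 (2.30) p. 580; [Balaban1982Higgs1] (1.7) p. 605, (2.20)–(2.23) p. 610.  Cell `lit-balaban`,
reader/typer seat **r14** gen 14 (unit `lit-balaban-r14`; TAKING line HOME/STATUS.md 2026-08-22T07:18:39Z; design note
`lit-balaban-r14/DESIGN-deltaG-pairings.md`); SKELETON rows **B1.Prop2.3 / B1.Prop2.1** (cells: the `δG` input of (2.38)/(5.5) at the `G`-level)
and r01's **B4.Cor2.3** (model-instance material; no head change).  USED BY NAME, never restated: r14 g14 `B1Cor23RegularRegion.{covDeriv_eq,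
pairing_of_coercive, propagatorK_supported}`, `B1Cor23DerivRegularRegion.pairing_DG_of_coercive_any`, `B1Ineq18RegularRegion.{coercive_covOpK_regular_region_uniform,
gammaReg_pos}`, `B1Cor23RegularRegion.delta_admissible`; typer `HiggsCovariancePos.{siteInner_covLaplacianN, covOpK_propagatorK_apply}`,
`B1Eq230FluctCovPos.siteInner_propagatorK_comm`, `B1Cor23RegularRegion.siteInner_projPk_eq`, `B2Restr216Lattice.norm_U_apply`, `B1Eq353SupNorm.card_blockK`,
`HiggsCovariancePos.{propagatorK_covOpK_apply, covOpK_propagatorK_apply}`, `B1Ineq233Upper.sum_bond_src_sq`, `B1Ineq234Concrete.tdist_self`, `B1Ineq234LevelZero.tdist_comm`.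

WHAT IS PRINTED (verbatim, [13] p. 581 L1–2 [PDF 11], the sentence after (2.30) — re-keyed in v1.2 (doc-only; referee note S-B1-g46-1):
v1.0/v1.1 carried here a PARAPHRASE (ours) «the corresponding expressions with δG_k … the right side of (2.30) multiplied by …» mislabelled
verbatim): *"The same inequalities hold for δG_k(Ω,Ω₀,A) with the additional factor e^{−δ₀(dist(supp f,Ωᶜ)+dist(supp f′,Ωᶜ))}"*; p. 581 L3–6:
*"Of course it is enough to prove it for f, f′ with supports in unit cubes, and the proof proceeds as before using only the L₂-bounds of
Lemma 2.1. Let us notice also that now there are no restrictions on supports of f, f′, so in this aspect the Corollary is a little bit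
stronger than Proposition I.2.1."*; p. 573 (1.11): *"δG_k(Ω,Ω₀,A) = G_k(Ω,A) − G_k(Ω₀,A)"* (`Ω ⊂ Ω₀`).

THE ARGUMENT (this file's; NOT the print's random walk — a disclosed divergence serving the printed STATEMENT).  With `u = G_Ωf′`, `u₀ = G_Ω₀f′`
and a cutoff `χ` (`0 ≤ χ ≤ 1`, `χ = 0` off `Ω` and at both ends of every bond of `Ω₀` not inside `Ω`, `|χ(b₊) − χ(b₋)| ≤ κ`, block oscillation
`≤ κ′`): `⟨f, δGf′⟩ = ⟨f, G_Ω((1−χ)f′)⟩ − ⟨G_Ωf, E⟩ − ⟨(1−χ)f, u₀⟩` where `H_Ω(χu₀) = χf′ + E`, and `E` is a FIRST-ORDER commutator: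
`⟨v, E⟩ = Σ_{b⊂Ω} ε^d·ε^{−1}(χ(b₊)−χ(b₋))·[⟪D_Av(b), u₀(b₋)⟫ − ⟪v(b₋), D_Au₀(b)⟫] + a_k(L^kε)^{−2}(⟨v, P_k(χu₀)⟩ − ⟨χv, P_ku₀⟩)` (exact; no `Δχ`
term), the `P_k` part bounded by `2κ′‖1v‖‖1u₀‖` (block oscillation, Jensen on blocks).  Every factor is a restricted norm of `G_Ωf`, `D_AG_Ωf`,
`G_Ω₀f′`, `D_AG_Ω₀f′` on the transition set of `χ`, which r14 g14's pairings bound with exponential decay in the separation from `supp f` /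
`supp f′` (duality: the restricted field itself is the test function).

WHAT THIS FILE PROVES (kernel-checked, zero `sorry`, theorems only; axioms standard).
* §1 **`covDeriv_smulFun`** (`D_A(χw)(b) = χ(b₊)D_Aw(b) + ε^{−1}(χ(b₊)−χ(b₋))w(b₋)`), `siteInner_smulFun_comm`.
* §2 **`lap_commutator_eq`** (the EXACT first-order identity `⟨v, −Δ^N_{A,Ω}(χu)⟩ − ⟨χv, −Δ^N_{A,Ω₀}u⟩ = Σ_{b⊂Ω} ε^d·ε^{−1}(χ(b₊)−χ(b₋))·(⟪D_Av(b),
  u(b₋)⟫ − ⟪v(b₋), D_Au(b)⟫)` for `Ω ⊆ Ω₀` and `χ` vanishing at both ends of the bonds of `Ω₀` not inside `Ω`), **`abs_lap_commutator_le`**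
  (`≤ (κ/ε)Σ_{b∈S} ε^d(|D_Av||u(b₋)| + |v(b₋)||D_Au|)` for `|χ(b₊)−χ(b₋)| ≤ κ`, `S ⊇` the bonds of `Ω` where `χ` jumps).
* §3 (private) `block_jensen`, `block_sum_norm_sq_eq`; **`projPk_commutator_le`** (`|⟨v, P_k(A)(χu)⟩ − ⟨χv, P_k(A)u⟩| ≤ 2κ′‖1_{B^k(Y)}v‖‖1_{B^k(Y)}u‖`
  for `χ` with block oscillation `≤ κ′`, constant on the blocks outside `Y`).
* §4 (private) `sqrt_le_of_sq_le`; **`restricted_norm_G_le`** (`‖1_SG^ε_k(Ω,A)f‖ ≤ (2/γ)(L^kε)²e^{−δr/L^k}‖f‖` for `f ⊂ Ω`, `S` at distance `≥ r`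
  from `supp f`), **`restricted_norm_DG_le`** (`‖1_SD^ε_AG^ε_k(Ω,A)f‖ ≤ (2/√γ + 4√d·δ/γ)(L^kε)e^{δ}e^{−δr/L^k}‖f‖` for bond sets `S` inside `Ω`) — by
  duality from r14 g14's `pairing_of_coercive` / `pairing_DG_of_coercive_any` (the restricted field itself as the test function).
* §5 (v1.1, append-only; private `sum_bond_le`, `sqrt_siteInner_oneSub_le`, `exists_of_siteInner_ne_zero`) **`deltaG_pairing_of_cutoff`**: for
  `Ω ⊆ Ω₀` unions of `k`-blocks, (2.20)-coercivity `γ` at `A` on the `Ω`- and the `Ω₀`-supported fields, admissible `δ`, a cutoff `0 ≤ χ ≤ 1`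
  vanishing at both ends of the bonds of `Ω₀` not inside `Ω` with bond jumps `≤ κ`, block oscillation `≤ κ′`, constant on the blocks outside `Y`,
  a bond set `S ⊂ Ω` carrying the jumps, a transition set `T ⊇ {x ∈ Ω : χ ≠ 1} ∪ src S ∪ B^k(Y)`, and `f, f′ ⊂ Ω` at lattice distance `≥ r, r′`
  from `T`:  `|⟨f, (G^ε_k(Ω,A) − G^ε_k(Ω₀,A))f′⟩| ≤ [4/γ + κε^{−1}(L^kε)·2√d·c_D·(2/γ)e^{δ} + 2κ′a_k(2/γ)²]·(L^kε)²e^{−δr/L^k}e^{−δr′/L^k}‖f‖‖f′‖`,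
  `c_D = 2/√γ + 4√d·δ/γ` — via the exact split `⟨f, δGf′⟩ = ⟨f, G_Ω((1−χ)f′)⟩ − ⟨G_Ωf, E⟩ − ⟨(1−χ)f, G_Ω₀f′⟩`, `⟨G_Ωf, E⟩` = the §2 + §3
  commutators (the mass terms cancel), every factor a §4 norm, the two boundary terms vanishing unless `r′ ≤ 0` resp. `r ≤ 0`.
HONEST SCOPE.  (i) the cutoff `χ`, the sets `S, Y, T` and the separations `r, r′` are HYPOTHESES: constructing an adapted cutoff with `κ ≍
1/(ML^k)` (so that the middle constant is uniform in `k`), `T` inside an `(M+2)L^k`-collar of `∂Ω`, and converting `r, r′` into the printed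
`dist(supp f, Ωᶜ)`, `dist(supp f′, Ωᶜ)` (and the joint decay in `dist(supp f, supp f′)` by combining with the plain first pairings) is the
successor's step (design note); (ii) only the plain pairing (the three derivative variants follow the same scheme); (iii) METHOD divergence from
the print (no random walk) as stated; constants explicit and crude; (iv) NOT summit progress.
-/

noncomputable section

open scoped BigOperators InnerProductSpace

namespace Literature.MathematicalPhysics.QuantumFieldTheory.Balaban1983to89.B1DeltaGRegularRegion

open HiggsLattice HiggsAveraging HiggsCovariance HiggsCovariancePos
open HiggsCovarianceCont (sNorm sNorm_nonneg sNorm_sq abs_siteInner_le)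
open HiggsFluctMeasurePos (siteInner_comm siteInner_add_right siteInner_smul_right siteInner_sub_right)
open B2Ineq329ZeroAveraging (mesh_eq mesh_pow_d)
open B2Restr216Lattice (norm_U_apply)
open B1Eq353SupNorm (card_blockK)
open B1Cor23RegularRegion (covDeriv_eq siteInner_projPk_eq pairing_of_coercive propagatorK_supported delta_admissible)
open B1Cor23DerivRegularRegion (pairing_DG_of_coercive_any)
open B1Ineq18RegularRegion (coercive_covOpK_regular_region_uniform gammaReg_pos)
open B1Eq230FluctCovPos (siteInner_propagatorK_comm)
open B1Ineq234Concrete (tdist_self)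
open B1Ineq234LevelZero (tdist_comm)
open B1Ineq233Upper (sum_bond_src_sq)

variable {P : HiggsLattice.Params} {N : ℕ} {k : ℕ}

/-! ## §1 The covariant Leibniz rule for a scalar cutoff -/

section Leibniz

variable (C : ChargeData N)

/-- **`D_A(χw)(b) = χ(b₊)D_Aw(b) + ε^{−1}(χ(b₊) − χ(b₋))w(b₋)`** (`U(A_b)` is linear). [cite: Balaban1982Higgs1, (1.7) p.605] -/
theorem covDeriv_smulFun (A : HiggsLattice.VecField P 0) (χ : HiggsLattice.Site P 0 → ℝ) (w : ScalarField P 0 N)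
    (b : HiggsLattice.PBond P 0) :
    covDeriv C A (fun x => χ x • w x) b
      = χ b.tgt • covDeriv C A w b + ((P.mesh 0)⁻¹ * (χ b.tgt - χ b.src)) • w b.src := by
  rw [covDeriv_eq, covDeriv_eq, ContinuousLinearMap.map_smul]
  module

/-- `⟨v, χ·w⟩ = ⟨χ·v, w⟩` (real scalar cutoff). [cite: Balaban1982Higgs1, (1.5) p.604] -/
theorem siteInner_smulFun_comm (χ : HiggsLattice.Site P 0 → ℝ) (v w : ScalarField P 0 N) :
    siteInner v (fun x => χ x • w x) = siteInner (fun x => χ x • v x) w := by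
  unfold siteInner
  refine Finset.sum_congr rfl fun x _ => ?_
  rw [real_inner_smul_right, real_inner_smul_left]

end Leibniz

/-! ## §2 The exact first-order commutator identity for the Neumann forms -/

section Commutator

variable (C : ChargeData N) (A : HiggsLattice.VecField P 0)

/-- **THE COMMUTATOR IN DIVERGENCE FORM** (exact): for `Ω ⊆ Ω₀` and a cutoff `χ` vanishing at both ends of every bond inside `Ω₀` that is
not inside `Ω`, and all `v, u`:
`⟨v, −Δ^N_{A,Ω}(χu)⟩ − ⟨χv, −Δ^N_{A,Ω₀}u⟩ = Σ_{b⊂Ω} ε^d·ε^{−1}(χ(b₊) − χ(b₋))·(⟪D_Av(b), u(b₋)⟫ − ⟪v(b₋), D_Au(b)⟫)` — FIRST ORDER in `χ`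
(the `χ(b₊)⟪D_Av, D_Au⟫` terms cancel; no discrete `Δχ` appears). [cite: Balaban1982Higgs1, (2.17) p.610, (1.7) p.605] -/
theorem lap_commutator_eq (Ω Ω₀ : Finset (HiggsLattice.Site P 0)) (hsub : Ω ⊆ Ω₀) (χ : HiggsLattice.Site P 0 → ℝ)
    (hχ : ∀ b : HiggsLattice.PBond P 0, Inside Ω₀ b → ¬ Inside Ω b → χ b.src = 0 ∧ χ b.tgt = 0)
    (v u : ScalarField P 0 N) :
    siteInner v (covLaplacianN C Ω A (fun x => χ x • u x))
        - siteInner (fun x => χ x • v x) (covLaplacianN C Ω₀ A u)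
      = ∑ b : HiggsLattice.PBond P 0, if Inside Ω b then
          P.mesh 0 ^ P.d * (((P.mesh 0)⁻¹ * (χ b.tgt - χ b.src)) *
            (⟪covDeriv C A v b, u b.src⟫_ℝ - ⟪v b.src, covDeriv C A u b⟫_ℝ)) else 0 := by
  rw [siteInner_covLaplacianN, siteInner_covLaplacianN, ← Finset.sum_sub_distrib]
  refine Finset.sum_congr rfl fun b _ => ?_
  by_cases hb : Inside Ω b
  · have hb₀ : Inside Ω₀ b := ⟨hsub hb.1, hsub hb.2⟩
    rw [if_pos hb, if_pos hb₀, if_pos hb, covDeriv_smulFun, covDeriv_smulFun, inner_add_right, inner_add_left,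
      real_inner_smul_right, real_inner_smul_left, real_inner_smul_right, real_inner_smul_left, real_inner_comm (covDeriv C A u b)]
    ring
  · rw [if_neg hb, if_neg hb]
    by_cases hb₀ : Inside Ω₀ b
    · obtain ⟨hs, ht⟩ := hχ b hb₀ hb
      rw [if_pos hb₀, covDeriv_smulFun, hs, ht, sub_self, mul_zero, zero_smul, zero_smul, add_zero, inner_zero_left,
        mul_zero, sub_zero]
    · rw [if_neg hb₀, sub_zero]

/-- **The commutator BOUND**: with `|χ(b₊) − χ(b₋)| ≤ κ` on every bond and a bond set `S ⊇ {b ⊂ Ω : χ(b₊) ≠ χ(b₋)}`,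
`|⟨v, −Δ_Ω(χu)⟩ − ⟨χv, −Δ_{Ω₀}u⟩| ≤ (κ/ε)·Σ_{b∈S} ε^d(|D_Av(b)||u(b₋)| + |v(b₋)||D_Au(b)|)`. [cite: Balaban1983RegularityDecay, Cor. 2.3 p.580] -/
theorem abs_lap_commutator_le (Ω Ω₀ : Finset (HiggsLattice.Site P 0)) (hsub : Ω ⊆ Ω₀) (χ : HiggsLattice.Site P 0 → ℝ)
    (hχ : ∀ b : HiggsLattice.PBond P 0, Inside Ω₀ b → ¬ Inside Ω b → χ b.src = 0 ∧ χ b.tgt = 0)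
    {κ : ℝ} (hκ0 : 0 ≤ κ) (hκ : ∀ b : HiggsLattice.PBond P 0, |χ b.tgt - χ b.src| ≤ κ)
    (S : Finset (HiggsLattice.PBond P 0)) (hS : ∀ b, Inside Ω b → χ b.tgt ≠ χ b.src → b ∈ S)
    (v u : ScalarField P 0 N) :
    |siteInner v (covLaplacianN C Ω A (fun x => χ x • u x)) - siteInner (fun x => χ x • v x) (covLaplacianN C Ω₀ A u)|
      ≤ κ * (P.mesh 0)⁻¹ * ∑ b ∈ S, P.mesh 0 ^ P.d *
          (‖covDeriv C A v b‖ * ‖u b.src‖ + ‖v b.src‖ * ‖covDeriv C A u b‖) := by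
  classical
  have hm0 : 0 < P.mesh 0 := P.mesh_pos 0
  have hmd : 0 < P.mesh 0 ^ P.d := pow_pos hm0 _
  rw [lap_commutator_eq C A Ω Ω₀ hsub χ hχ v u]
  -- compare termwise with the majorant supported on S
  have hterm : ∀ b : HiggsLattice.PBond P 0,
      |(if Inside Ω b then P.mesh 0 ^ P.d * (((P.mesh 0)⁻¹ * (χ b.tgt - χ b.src)) *
          (⟪covDeriv C A v b, u b.src⟫_ℝ - ⟪v b.src, covDeriv C A u b⟫_ℝ)) else 0)|
        ≤ if b ∈ S then κ * (P.mesh 0)⁻¹ * (P.mesh 0 ^ P.d *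
            (‖covDeriv C A v b‖ * ‖u b.src‖ + ‖v b.src‖ * ‖covDeriv C A u b‖)) else 0 := by
    intro b
    by_cases hb : Inside Ω b
    · rw [if_pos hb]
      by_cases hd : χ b.tgt = χ b.src
      · rw [hd, sub_self, mul_zero, zero_mul, mul_zero, abs_zero]
        split_ifs <;> positivity
      · rw [if_pos (hS b hb hd), abs_mul, abs_of_pos hmd, abs_mul, abs_mul, abs_of_pos (inv_pos.2 hm0)]
        have h1 : |⟪covDeriv C A v b, u b.src⟫_ℝ - ⟪v b.src, covDeriv C A u b⟫_ℝ|
            ≤ ‖covDeriv C A v b‖ * ‖u b.src‖ + ‖v b.src‖ * ‖covDeriv C A u b‖ :=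
          (abs_sub _ _).trans (add_le_add (abs_real_inner_le_norm _ _) (abs_real_inner_le_norm _ _))
        have h2 := hκ b
        have hA : 0 ≤ ‖covDeriv C A v b‖ * ‖u b.src‖ + ‖v b.src‖ * ‖covDeriv C A u b‖ := by positivity
        calc P.mesh 0 ^ P.d * ((P.mesh 0)⁻¹ * |χ b.tgt - χ b.src| * |⟪covDeriv C A v b, u b.src⟫_ℝ - ⟪v b.src, covDeriv C A u b⟫_ℝ|)
            ≤ P.mesh 0 ^ P.d * ((P.mesh 0)⁻¹ * κ * (‖covDeriv C A v b‖ * ‖u b.src‖ + ‖v b.src‖ * ‖covDeriv C A u b‖)) := by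
              refine mul_le_mul_of_nonneg_left ?_ hmd.le
              exact mul_le_mul (mul_le_mul_of_nonneg_left h2 (inv_pos.2 hm0).le) h1 (abs_nonneg _) (by positivity)
          _ = _ := by ring
    · rw [if_neg hb, abs_zero]
      split_ifs <;> positivity
  calc _ ≤ ∑ b : HiggsLattice.PBond P 0, |(if Inside Ω b then P.mesh 0 ^ P.d * (((P.mesh 0)⁻¹ * (χ b.tgt - χ b.src)) *
          (⟪covDeriv C A v b, u b.src⟫_ℝ - ⟪v b.src, covDeriv C A u b⟫_ℝ)) else 0)| := Finset.abs_sum_le_sum_abs _ _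
    _ ≤ ∑ b : HiggsLattice.PBond P 0, (if b ∈ S then κ * (P.mesh 0)⁻¹ * (P.mesh 0 ^ P.d *
            (‖covDeriv C A v b‖ * ‖u b.src‖ + ‖v b.src‖ * ‖covDeriv C A u b‖)) else 0) := Finset.sum_le_sum fun b _ => hterm b
    _ = _ := by rw [← Finset.sum_filter, Finset.filter_mem_eq_inter, Finset.univ_inter, Finset.mul_sum]

end Commutator

/-! ## §3 The `P_k(A)` commutator: block oscillation of the cutoff -/

section ProjCommutator

variable (C : ChargeData N) (A : HiggsLattice.VecField P 0)

/-- Jensen on a block for the transported field: `|L^{−kd}Σ_{x∈B^k(y)} c(x)·U_xw(x)| ≤ (sup_B|c|)·(L^{−kd}Σ_{x∈B}‖w(x)‖²)^{1/2}`, in the squared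
form `(L^{−kd}Σ_x |c x|‖w x‖)² ≤ s²·L^{−kd}Σ_x ‖w x‖²` for `|c| ≤ s` on the block. [folklore] -/
private theorem block_jensen (hk : k ≤ P.K) (y : HiggsLattice.Site P k) (c : HiggsLattice.Site P 0 → ℝ) {s : ℝ}
    (hc : ∀ x ∈ blockK k y, |c x| ≤ s) (w : ScalarField P 0 N) :
    (((P.L : ℝ) ^ (k * P.d))⁻¹ * ∑ x ∈ blockK k y, |c x| * ‖w x‖) ^ 2
      ≤ s ^ 2 * (((P.L : ℝ) ^ (k * P.d))⁻¹ * ∑ x ∈ blockK k y, ‖w x‖ ^ 2) := by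
  have hLpos : (0 : ℝ) < (P.L : ℝ) ^ (k * P.d) := pow_pos (by exact_mod_cast P.hL) _
  have hcard : ((blockK k y).card : ℝ) = (P.L : ℝ) ^ (k * P.d) := by
    rw [card_blockK hk y]; push_cast; ring
  -- Σ |c|‖w‖ ≤ s Σ ‖w‖ and (Σ ‖w‖)² ≤ |B| Σ ‖w‖²
  have h1 : ∑ x ∈ blockK k y, |c x| * ‖w x‖ ≤ s * ∑ x ∈ blockK k y, ‖w x‖ := by
    rw [Finset.mul_sum]
    exact Finset.sum_le_sum fun x hx => mul_le_mul_of_nonneg_right (hc x hx) (norm_nonneg _)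
  have h0 : 0 ≤ ∑ x ∈ blockK k y, |c x| * ‖w x‖ := Finset.sum_nonneg fun x _ => by positivity
  have h2 : (∑ x ∈ blockK k y, ‖w x‖) ^ 2 ≤ (blockK k y).card * ∑ x ∈ blockK k y, ‖w x‖ ^ 2 := by
    have := Finset.sum_mul_sq_le_sq_mul_sq (blockK k y) (fun _ => (1 : ℝ)) (fun x => ‖w x‖)
    simp only [one_pow, Finset.sum_const, nsmul_eq_mul, mul_one, one_mul] at this
    exact this
  rw [hcard] at h2
  calc (((P.L : ℝ) ^ (k * P.d))⁻¹ * ∑ x ∈ blockK k y, |c x| * ‖w x‖) ^ 2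
      ≤ (((P.L : ℝ) ^ (k * P.d))⁻¹ * (s * ∑ x ∈ blockK k y, ‖w x‖)) ^ 2 :=
        pow_le_pow_left₀ (by positivity) (mul_le_mul_of_nonneg_left h1 (inv_pos.2 hLpos).le) 2
    _ = s ^ 2 * ((((P.L : ℝ) ^ (k * P.d))⁻¹) ^ 2 * (∑ x ∈ blockK k y, ‖w x‖) ^ 2) := by ring
    _ ≤ s ^ 2 * ((((P.L : ℝ) ^ (k * P.d))⁻¹) ^ 2 * ((P.L : ℝ) ^ (k * P.d) * ∑ x ∈ blockK k y, ‖w x‖ ^ 2)) :=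
        mul_le_mul_of_nonneg_left (mul_le_mul_of_nonneg_left h2 (by positivity)) (sq_nonneg _)
    _ = s ^ 2 * (((P.L : ℝ) ^ (k * P.d))⁻¹ * ∑ x ∈ blockK k y, ‖w x‖ ^ 2) := by
        field_simp

/-- The `ε`-lattice norm² of a field restricted to a union of `k`-blocks, as a block sum:
`Σ_{y∈Y} (L^kε)^d·L^{−kd}Σ_{x∈B^k(y)}‖w x‖² = ⟨1_{B^k(Y)}w, 1_{B^k(Y)}w⟩ ≤ ⟨w,w⟩` — here only the inequality with the full norm of the
restriction `wY := 1[x_k ∈ Y]·w`. [cite: Balaban1982Higgs1, (1.5) p.604] -/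
private theorem block_sum_norm_sq_eq (Y : Finset (HiggsLattice.Site P k)) (w : ScalarField P 0 N) :
    ∑ y ∈ Y, P.mesh k ^ P.d * (((P.L : ℝ) ^ (k * P.d))⁻¹ * ∑ x ∈ blockK k y, ‖w x‖ ^ 2)
      = siteInner (fun x => if blockIter k x ∈ Y then w x else 0) (fun x => if blockIter k x ∈ Y then w x else 0) := by
  classical
  have hLpos : (0 : ℝ) < (P.L : ℝ) ^ (k * P.d) := pow_pos (by exact_mod_cast P.hL) _
  have hcoef : P.mesh k ^ P.d * ((P.L : ℝ) ^ (k * P.d))⁻¹ = P.mesh 0 ^ P.d := by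
    rw [mesh_pow_d]; field_simp
  unfold siteInner
  -- regroup the site sum by blocks
  have hsplit : ∑ x : HiggsLattice.Site P 0, P.mesh 0 ^ P.d *
      ⟪(if blockIter k x ∈ Y then w x else 0), (if blockIter k x ∈ Y then w x else 0)⟫_ℝ
      = ∑ y ∈ Y, ∑ x ∈ blockK k y, P.mesh 0 ^ P.d * ‖w x‖ ^ 2 := by
    rw [← Finset.sum_fiberwise_of_maps_to (s := Finset.univ) (t := Finset.univ) (g := fun x => blockIter k x) (fun x _ => Finset.mem_univ _)]
    have hY : ∑ y : HiggsLattice.Site P k, ∑ x ∈ Finset.univ.filter (fun x => blockIter k x = y),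
        P.mesh 0 ^ P.d * ⟪(if blockIter k x ∈ Y then w x else 0), (if blockIter k x ∈ Y then w x else 0)⟫_ℝ
        = ∑ y : HiggsLattice.Site P k, if y ∈ Y then ∑ x ∈ blockK k y, P.mesh 0 ^ P.d * ‖w x‖ ^ 2 else 0 := by
      refine Finset.sum_congr rfl fun y _ => ?_
      by_cases hy : y ∈ Y
      · rw [if_pos hy]
        refine Finset.sum_congr (by ext x; simp [blockK]) fun x hx => ?_
        have hx' : blockIter k x = y := (Finset.mem_filter.1 hx).2
        rw [hx', if_pos hy, real_inner_self_eq_norm_sq]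
      · rw [if_neg hy]
        refine Finset.sum_eq_zero fun x hx => ?_
        have hx' : blockIter k x = y := (Finset.mem_filter.1 hx).2
        rw [hx', if_neg hy, inner_zero_left, mul_zero]
    rw [hY, ← Finset.sum_filter, Finset.filter_mem_eq_inter, Finset.univ_inter]
  rw [hsplit]
  refine Finset.sum_congr rfl fun y _ => ?_
  rw [← mul_assoc, hcoef, Finset.mul_sum]

/-- **THE `P_k(A)` COMMUTATOR BOUND**: if the cutoff oscillates by at most `κ′` on every `k`-block (`|χ x − χ x′| ≤ κ′` for `x_k = x′_k`) and
is CONSTANT on every block outside the block set `Y`, then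
`|⟨v, P_k(A)(χu)⟩ − ⟨χv, P_k(A)u⟩| ≤ 2κ′·‖1_{B^k(Y)}v‖·‖1_{B^k(Y)}u‖` (subtract the block constant `χ(x_y)`; Jensen on blocks; unitarity of the
transports). [cite: Balaban1982Higgs1, (2.11) p.609, (2.20) p.610] -/
theorem projPk_commutator_le (hk : k ≤ P.K) (χ : HiggsLattice.Site P 0 → ℝ) {κ' : ℝ} (hκ0 : 0 ≤ κ')
    (hosc : ∀ x x' : HiggsLattice.Site P 0, blockIter k x = blockIter k x' → |χ x - χ x'| ≤ κ')
    (Y : Finset (HiggsLattice.Site P k))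
    (hY : ∀ x x' : HiggsLattice.Site P 0, blockIter k x = blockIter k x' → blockIter k x ∉ Y → χ x = χ x')
    (v u : ScalarField P 0 N) :
    |siteInner v (projPk C A k (fun x => χ x • u x)) - siteInner (fun x => χ x • v x) (projPk C A k u)|
      ≤ 2 * κ' * Real.sqrt (siteInner (fun x => if blockIter k x ∈ Y then v x else 0) (fun x => if blockIter k x ∈ Y then v x else 0))
          * Real.sqrt (siteInner (fun x => if blockIter k x ∈ Y then u x else 0) (fun x => if blockIter k x ∈ Y then u x else 0)) := by
  classical
  have hLpos : (0 : ℝ) < (P.L : ℝ) ^ (k * P.d) := pow_pos (by exact_mod_cast P.hL) _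
  have hmk : 0 < P.mesh k ^ P.d := pow_pos (P.mesh_pos k) _
  rw [siteInner_projPk_eq, siteInner_projPk_eq, ← Finset.sum_sub_distrib]
  -- transported fields and a representative point of each block
  set Tv : ScalarField P 0 N := fun x => C.U (P.mesh 0) (multiContourSum A k x) (v x) with hTv
  set Tu : ScalarField P 0 N := fun x => C.U (P.mesh 0) (multiContourSum A k x) (u x) with hTu
  have hTvn : ∀ x, ‖Tv x‖ = ‖v x‖ := fun x => norm_U_apply C _ _ _
  have hTun : ∀ x, ‖Tu x‖ = ‖u x‖ := fun x => norm_U_apply C _ _ _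
  have htr : ∀ (w : ScalarField P 0 N) x, C.U (P.mesh 0) (multiContourSum A k x) (χ x • w x)
      = χ x • C.U (P.mesh 0) (multiContourSum A k x) (w x) := fun w x => by rw [ContinuousLinearMap.map_smul]
  simp_rw [htr]
  -- per-block identity: subtract the block constant
  set nv : HiggsLattice.Site P k → ℝ := fun y => ((P.L : ℝ) ^ (k * P.d))⁻¹ * ∑ x ∈ blockK k y, ‖v x‖ ^ 2 with hnv
  set nu : HiggsLattice.Site P k → ℝ := fun y => ((P.L : ℝ) ^ (k * P.d))⁻¹ * ∑ x ∈ blockK k y, ‖u x‖ ^ 2 with hnu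
  have hblock : ∀ y : HiggsLattice.Site P k,
      |P.mesh k ^ P.d * ((((P.L : ℝ) ^ (k * P.d))⁻¹) ^ 2 *
          ∑ x ∈ blockK k y, ∑ x' ∈ blockK k y, ⟪Tv x, χ x' • Tu x'⟫_ℝ)
        - P.mesh k ^ P.d * ((((P.L : ℝ) ^ (k * P.d))⁻¹) ^ 2 *
          ∑ x ∈ blockK k y, ∑ x' ∈ blockK k y, ⟪χ x • Tv x, Tu x'⟫_ℝ)|
        ≤ if y ∈ Y then P.mesh k ^ P.d * (2 * κ' * (Real.sqrt (nv y) * Real.sqrt (nu y))) else 0 := by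
    intro y
    -- a representative of the block (blocks are nonempty: y has a preimage)
    by_cases hyY : y ∈ Y
    · rw [if_pos hyY]
      obtain ⟨x₀, hx₀⟩ : ∃ x₀ : HiggsLattice.Site P 0, x₀ ∈ blockK k y := by
        have hc : (blockK k y).card = P.L ^ (k * P.d) := card_blockK hk y
        have hpos : 0 < (blockK k y).card := by rw [hc]; exact pow_pos P.hL _
        exact Finset.card_pos.1 hpos
      set c₀ := χ x₀ with hc₀
      -- rewrite both double sums with χ − c₀ (the c₀ parts cancel)
      have hdiff : P.mesh k ^ P.d * ((((P.L : ℝ) ^ (k * P.d))⁻¹) ^ 2 *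
            ∑ x ∈ blockK k y, ∑ x' ∈ blockK k y, ⟪Tv x, χ x' • Tu x'⟫_ℝ)
          - P.mesh k ^ P.d * ((((P.L : ℝ) ^ (k * P.d))⁻¹) ^ 2 *
            ∑ x ∈ blockK k y, ∑ x' ∈ blockK k y, ⟪χ x • Tv x, Tu x'⟫_ℝ)
          = P.mesh k ^ P.d * ((((P.L : ℝ) ^ (k * P.d))⁻¹) ^ 2 *
            (⟪∑ x ∈ blockK k y, Tv x, ∑ x' ∈ blockK k y, (χ x' - c₀) • Tu x'⟫_ℝ
              - ⟪∑ x ∈ blockK k y, (χ x - c₀) • Tv x, ∑ x' ∈ blockK k y, Tu x'⟫_ℝ)) := by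
        have eA : ⟪∑ x ∈ blockK k y, Tv x, ∑ x' ∈ blockK k y, (χ x' - c₀) • Tu x'⟫_ℝ
            = ∑ x ∈ blockK k y, ∑ x' ∈ blockK k y, (χ x' - c₀) * ⟪Tv x, Tu x'⟫_ℝ := by
          simp only [sum_inner, inner_sum, real_inner_smul_right]
          rw [Finset.sum_comm]
        have eB : ⟪∑ x ∈ blockK k y, (χ x - c₀) • Tv x, ∑ x' ∈ blockK k y, Tu x'⟫_ℝ
            = ∑ x ∈ blockK k y, ∑ x' ∈ blockK k y, (χ x - c₀) * ⟪Tv x, Tu x'⟫_ℝ := by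
          simp only [sum_inner, inner_sum, real_inner_smul_left]
          rw [Finset.sum_comm]
        have eL1 : ∑ x ∈ blockK k y, ∑ x' ∈ blockK k y, ⟪Tv x, χ x' • Tu x'⟫_ℝ
            = ∑ x ∈ blockK k y, ∑ x' ∈ blockK k y, χ x' * ⟪Tv x, Tu x'⟫_ℝ := by
          simp only [real_inner_smul_right]
        have eL2 : ∑ x ∈ blockK k y, ∑ x' ∈ blockK k y, ⟪χ x • Tv x, Tu x'⟫_ℝ
            = ∑ x ∈ blockK k y, ∑ x' ∈ blockK k y, χ x * ⟪Tv x, Tu x'⟫_ℝ := by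
          simp only [real_inner_smul_left]
        have eS : ∑ x ∈ blockK k y, ∑ x' ∈ blockK k y, (χ x' - c₀) * ⟪Tv x, Tu x'⟫_ℝ
              - ∑ x ∈ blockK k y, ∑ x' ∈ blockK k y, (χ x - c₀) * ⟪Tv x, Tu x'⟫_ℝ
            = ∑ x ∈ blockK k y, ∑ x' ∈ blockK k y, χ x' * ⟪Tv x, Tu x'⟫_ℝ
              - ∑ x ∈ blockK k y, ∑ x' ∈ blockK k y, χ x * ⟪Tv x, Tu x'⟫_ℝ := by
          simp only [sub_mul, Finset.sum_sub_distrib]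
          ring
        rw [eA, eB, eL1, eL2, eS]
        ring
      rw [hdiff, abs_mul, abs_of_pos hmk]
      refine mul_le_mul_of_nonneg_left ?_ hmk.le
      rw [abs_mul, abs_of_nonneg (sq_nonneg _)]
      -- norms of the four block sums
      have hA1 : ‖∑ x ∈ blockK k y, Tv x‖ ≤ ∑ x ∈ blockK k y, |(1 : ℝ)| * ‖v x‖ := by
        refine (norm_sum_le _ _).trans (Finset.sum_le_sum fun x _ => ?_)
        rw [abs_one, one_mul, hTvn]
      have hA2 : ‖∑ x' ∈ blockK k y, (χ x' - c₀) • Tu x'‖ ≤ ∑ x' ∈ blockK k y, |χ x' - c₀| * ‖u x'‖ := by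
        refine (norm_sum_le _ _).trans (Finset.sum_le_sum fun x _ => ?_)
        rw [norm_smul, Real.norm_eq_abs, hTun]
      have hA3 : ‖∑ x ∈ blockK k y, (χ x - c₀) • Tv x‖ ≤ ∑ x ∈ blockK k y, |χ x - c₀| * ‖v x‖ := by
        refine (norm_sum_le _ _).trans (Finset.sum_le_sum fun x _ => ?_)
        rw [norm_smul, Real.norm_eq_abs, hTvn]
      have hA4 : ‖∑ x' ∈ blockK k y, Tu x'‖ ≤ ∑ x' ∈ blockK k y, |(1 : ℝ)| * ‖u x'‖ := by
        refine (norm_sum_le _ _).trans (Finset.sum_le_sum fun x _ => ?_)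
        rw [abs_one, one_mul, hTun]
      have hosc' : ∀ x ∈ blockK k y, |χ x - c₀| ≤ κ' := by
        intro x hx
        rw [hc₀]
        exact hosc x x₀ (by rw [(mem_blockK k y x).1 hx, (mem_blockK k y x₀).1 hx₀])
      have hone : ∀ x ∈ blockK k y, |(1 : ℝ)| ≤ 1 := fun _ _ => by rw [abs_one]
      -- Jensen on the block for each of the four sums
      have J1 := block_jensen hk y (fun _ => (1 : ℝ)) hone v
      have J2 := block_jensen hk y (fun x => χ x - c₀) hosc' u
      have J3 := block_jensen hk y (fun x => χ x - c₀) hosc' v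
      have J4 := block_jensen hk y (fun _ => (1 : ℝ)) hone u
      have hnv0 : 0 ≤ nv y := by rw [hnv]; positivity
      have hnu0 : 0 ≤ nu y := by rw [hnu]; positivity
      -- square roots
      have hS1 : ((P.L : ℝ) ^ (k * P.d))⁻¹ * ∑ x ∈ blockK k y, |(1 : ℝ)| * ‖v x‖ ≤ Real.sqrt (nv y) := by
        rw [Real.le_sqrt (by positivity) hnv0]
        simpa [one_pow, one_mul] using J1
      have hS2 : ((P.L : ℝ) ^ (k * P.d))⁻¹ * ∑ x ∈ blockK k y, |χ x - c₀| * ‖u x‖ ≤ κ' * Real.sqrt (nu y) := by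
        have h := Real.sqrt_le_sqrt J2
        rw [Real.sqrt_sq (by positivity), Real.sqrt_mul (sq_nonneg _), Real.sqrt_sq hκ0] at h
        exact h
      have hS3 : ((P.L : ℝ) ^ (k * P.d))⁻¹ * ∑ x ∈ blockK k y, |χ x - c₀| * ‖v x‖ ≤ κ' * Real.sqrt (nv y) := by
        have h := Real.sqrt_le_sqrt J3
        rw [Real.sqrt_sq (by positivity), Real.sqrt_mul (sq_nonneg _), Real.sqrt_sq hκ0] at h
        exact h
      have hS4 : ((P.L : ℝ) ^ (k * P.d))⁻¹ * ∑ x ∈ blockK k y, |(1 : ℝ)| * ‖u x‖ ≤ Real.sqrt (nu y) := by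
        rw [Real.le_sqrt (by positivity) hnu0]
        simpa [one_pow, one_mul] using J4
      have hI := Real.sqrt_nonneg (nv y)
      have hJ := Real.sqrt_nonneg (nu y)
      calc (((P.L : ℝ) ^ (k * P.d))⁻¹) ^ 2 *
            |⟪∑ x ∈ blockK k y, Tv x, ∑ x' ∈ blockK k y, (χ x' - c₀) • Tu x'⟫_ℝ
              - ⟪∑ x ∈ blockK k y, (χ x - c₀) • Tv x, ∑ x' ∈ blockK k y, Tu x'⟫_ℝ|
          ≤ (((P.L : ℝ) ^ (k * P.d))⁻¹) ^ 2 *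
            (‖∑ x ∈ blockK k y, Tv x‖ * ‖∑ x' ∈ blockK k y, (χ x' - c₀) • Tu x'‖
              + ‖∑ x ∈ blockK k y, (χ x - c₀) • Tv x‖ * ‖∑ x' ∈ blockK k y, Tu x'‖) := by
            refine mul_le_mul_of_nonneg_left ((abs_sub _ _).trans (add_le_add ?_ ?_)) (sq_nonneg _)
            · exact (abs_real_inner_le_norm _ _)
            · exact (abs_real_inner_le_norm _ _)
        _ ≤ (((P.L : ℝ) ^ (k * P.d))⁻¹) ^ 2 *
            ((∑ x ∈ blockK k y, |(1 : ℝ)| * ‖v x‖) * (∑ x' ∈ blockK k y, |χ x' - c₀| * ‖u x'‖)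
              + (∑ x ∈ blockK k y, |χ x - c₀| * ‖v x‖) * (∑ x' ∈ blockK k y, |(1 : ℝ)| * ‖u x'‖)) := by
            refine mul_le_mul_of_nonneg_left (add_le_add ?_ ?_) (sq_nonneg _)
            · exact mul_le_mul hA1 hA2 (norm_nonneg _) (Finset.sum_nonneg fun _ _ => by positivity)
            · exact mul_le_mul hA3 hA4 (norm_nonneg _) (Finset.sum_nonneg fun _ _ => by positivity)
        _ = (((P.L : ℝ) ^ (k * P.d))⁻¹ * ∑ x ∈ blockK k y, |(1 : ℝ)| * ‖v x‖)
              * (((P.L : ℝ) ^ (k * P.d))⁻¹ * ∑ x' ∈ blockK k y, |χ x' - c₀| * ‖u x'‖)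
            + (((P.L : ℝ) ^ (k * P.d))⁻¹ * ∑ x ∈ blockK k y, |χ x - c₀| * ‖v x‖)
              * (((P.L : ℝ) ^ (k * P.d))⁻¹ * ∑ x' ∈ blockK k y, |(1 : ℝ)| * ‖u x'‖) := by ring
        _ ≤ Real.sqrt (nv y) * (κ' * Real.sqrt (nu y)) + (κ' * Real.sqrt (nv y)) * Real.sqrt (nu y) := by
            refine add_le_add ?_ ?_
            · exact mul_le_mul hS1 hS2 (by positivity) hI
            · exact mul_le_mul hS3 hS4 (by positivity) (by positivity)
        _ = 2 * κ' * (Real.sqrt (nv y) * Real.sqrt (nu y)) := by ring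
    · -- χ constant on the block: both double sums agree
      rw [if_neg hyY]
      have hconst : ∀ x ∈ blockK k y, ∀ x' ∈ blockK k y, χ x = χ x' := by
        intro x hx x' hx'
        have hxx' : blockIter k x = blockIter k x' := by rw [(mem_blockK k y x).1 hx, (mem_blockK k y x').1 hx']
        exact hY x x' hxx' (by rw [(mem_blockK k y x).1 hx]; exact hyY)
      have heq : ∑ x ∈ blockK k y, ∑ x' ∈ blockK k y, ⟪Tv x, χ x' • Tu x'⟫_ℝ
          = ∑ x ∈ blockK k y, ∑ x' ∈ blockK k y, ⟪χ x • Tv x, Tu x'⟫_ℝ := by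
        refine Finset.sum_congr rfl fun x hx => Finset.sum_congr rfl fun x' hx' => ?_
        rw [inner_smul_right, inner_smul_left, hconst x hx x' hx']
        simp
      rw [heq, sub_self, abs_zero]
  -- sum the block bounds, then Cauchy–Schwarz over the blocks of Y
  refine le_trans (Finset.abs_sum_le_sum_abs _ _) ?_
  refine le_trans (Finset.sum_le_sum fun y (_ : y ∈ Finset.univ) => hblock y) ?_
  rw [← Finset.sum_filter, Finset.filter_mem_eq_inter, Finset.univ_inter]
  have hCS : ∑ y ∈ Y, P.mesh k ^ P.d * (2 * κ' * (Real.sqrt (nv y) * Real.sqrt (nu y)))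
      = 2 * κ' * ∑ y ∈ Y, P.mesh k ^ P.d * (Real.sqrt (nv y) * Real.sqrt (nu y)) := by
    rw [Finset.mul_sum]; exact Finset.sum_congr rfl fun y _ => by ring
  rw [hCS]
  have h2κ : 0 ≤ 2 * κ' := by linarith
  have h1 : ∑ y ∈ Y, P.mesh k ^ P.d * (Real.sqrt (nv y) * Real.sqrt (nu y))
      ≤ Real.sqrt (∑ y ∈ Y, P.mesh k ^ P.d * Real.sqrt (nv y) ^ 2) * Real.sqrt (∑ y ∈ Y, P.mesh k ^ P.d * Real.sqrt (nu y) ^ 2) := by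
    have hcs := Finset.sum_mul_sq_le_sq_mul_sq Y (fun y => Real.sqrt (nv y)) (fun y => Real.sqrt (nu y))
    have h1 : |∑ y ∈ Y, Real.sqrt (nv y) * Real.sqrt (nu y)|
        ≤ Real.sqrt ((∑ y ∈ Y, Real.sqrt (nv y) ^ 2) * ∑ y ∈ Y, Real.sqrt (nu y) ^ 2) := Real.abs_le_sqrt hcs
    rw [Real.sqrt_mul (Finset.sum_nonneg fun i _ => sq_nonneg _)] at h1
    have h2 := (le_abs_self _).trans h1
    rw [← Finset.mul_sum, ← Finset.mul_sum, ← Finset.mul_sum, Real.sqrt_mul hmk.le, Real.sqrt_mul hmk.le]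
    have hsc : Real.sqrt (P.mesh k ^ P.d) * Real.sqrt (P.mesh k ^ P.d) = P.mesh k ^ P.d := Real.mul_self_sqrt hmk.le
    calc P.mesh k ^ P.d * ∑ y ∈ Y, Real.sqrt (nv y) * Real.sqrt (nu y)
        ≤ P.mesh k ^ P.d * (Real.sqrt (∑ y ∈ Y, Real.sqrt (nv y) ^ 2) * Real.sqrt (∑ y ∈ Y, Real.sqrt (nu y) ^ 2)) :=
          mul_le_mul_of_nonneg_left h2 hmk.le
      _ = (Real.sqrt (P.mesh k ^ P.d) * Real.sqrt (P.mesh k ^ P.d)) *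
            (Real.sqrt (∑ y ∈ Y, Real.sqrt (nv y) ^ 2) * Real.sqrt (∑ y ∈ Y, Real.sqrt (nu y) ^ 2)) := by rw [hsc]
      _ = _ := by ring
  have e1 : ∑ y ∈ Y, P.mesh k ^ P.d * Real.sqrt (nv y) ^ 2 = ∑ y ∈ Y, P.mesh k ^ P.d * nv y :=
    Finset.sum_congr rfl fun y _ => by rw [Real.sq_sqrt (by rw [hnv]; positivity)]
  have e2 : ∑ y ∈ Y, P.mesh k ^ P.d * Real.sqrt (nu y) ^ 2 = ∑ y ∈ Y, P.mesh k ^ P.d * nu y :=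
    Finset.sum_congr rfl fun y _ => by rw [Real.sq_sqrt (by rw [hnu]; positivity)]
  rw [e1, e2, hnv, hnu, block_sum_norm_sq_eq, block_sum_norm_sq_eq] at h1
  calc 2 * κ' * ∑ y ∈ Y, P.mesh k ^ P.d * (Real.sqrt (nv y) * Real.sqrt (nu y))
      ≤ 2 * κ' * (Real.sqrt (siteInner (fun x => if blockIter k x ∈ Y then v x else 0) (fun x => if blockIter k x ∈ Y then v x else 0))
          * Real.sqrt (siteInner (fun x => if blockIter k x ∈ Y then u x else 0) (fun x => if blockIter k x ∈ Y then u x else 0))) := by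
        rw [hnv, hnu]
        exact mul_le_mul_of_nonneg_left h1 h2κ
    _ = _ := by ring

end ProjCommutator

/-! ## §4 Restricted norms of `G_k(Ω,A)f` and `D_AG_k(Ω,A)f` with decay, by duality from the pairings -/

section Restricted

variable (C : ChargeData N) (A : HiggsLattice.VecField P 0) {msq a : ℝ}

/-- `‖a‖² ≤ K·‖a‖·b`, `K, b ≥ 0` ⇒ `‖a‖ ≤ K·b` for `‖a‖ = √s`. [folklore] -/
private theorem sqrt_le_of_sq_le {s K b : ℝ} (hs : 0 ≤ s) (hK : 0 ≤ K) (hb : 0 ≤ b) (h : s ≤ K * Real.sqrt s * b) :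
    Real.sqrt s ≤ K * b := by
  by_cases h0 : Real.sqrt s = 0
  · rw [h0]; positivity
  · have hpos : 0 < Real.sqrt s := lt_of_le_of_ne (Real.sqrt_nonneg _) (Ne.symm h0)
    have h1 : Real.sqrt s * Real.sqrt s ≤ (K * b) * Real.sqrt s := by
      rw [Real.mul_self_sqrt hs]; linarith
    exact le_of_mul_le_mul_right h1 hpos

/-- **Restricted norm of `G^ε_k(Ω,A)f` with decay**: for `f ⊂ Ω` and a site set `S` at lattice distance `≥ r` from `supp f`,
`‖1_SG^ε_k(Ω,A)f‖ ≤ (2/γ)(L^kε)²e^{−δr/L^k}‖f‖` (the first pairing with the restricted field itself as test function).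
[cite: Balaban1983RegularityDecay, Cor. 2.3 (2.30) p.580] -/
theorem restricted_norm_G_le (hk : k ≤ P.K) (Ω : Finset (HiggsLattice.Site P 0))
    (hΩ : ∀ x x' : HiggsLattice.Site P 0, blockIter k x = blockIter k x' → (x ∈ Ω ↔ x' ∈ Ω))
    (hmsq : 0 < msq) (hak : 0 ≤ B1.aSeq a P.L k) {γ : ℝ} (hγ : 0 < γ)
    (hlow : ∀ w : ScalarField P 0 N, (∀ x, x ∉ Ω → w x = 0) →
      γ * ((P.mesh k)⁻¹ ^ 2) * siteInner w w ≤ siteInner w (covOpK C Ω A msq a k w))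
    {δ : ℝ} (hδ0 : 0 ≤ δ) (hδ1 : δ ≤ 1) (hδ : 2 * (2 * P.d * δ ^ 2 + B1.aSeq a P.L k * (2 * δ)) ≤ γ)
    (S : Finset (HiggsLattice.Site P 0)) (f : ScalarField P 0 N) (hf : ∀ x, x ∉ Ω → f x = 0) (r : ℝ)
    (hsep : ∀ x ∈ S, ∀ x', f x' ≠ 0 → r ≤ (HiggsLattice.Site.tdist x x' : ℝ)) :
    Real.sqrt (siteInner (fun x => if x ∈ S then propagatorK C Ω A msq a k f x else 0)
        (fun x => if x ∈ S then propagatorK C Ω A msq a k f x else 0))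
      ≤ 2 / γ * P.mesh k ^ 2 * Real.exp (-(δ * (r / (P.L : ℝ) ^ k))) * Real.sqrt (siteInner f f) := by
  classical
  set gS : ScalarField P 0 N := fun x => if x ∈ S then propagatorK C Ω A msq a k f x else 0 with hgS
  have hkey : siteInner gS gS = siteInner gS (propagatorK C Ω A msq a k f) := by
    unfold siteInner
    refine Finset.sum_congr rfl fun x _ => ?_
    by_cases hx : x ∈ S
    · simp only [hgS, if_pos hx]
    · simp only [hgS, if_neg hx, inner_zero_left]
  have hsep' : ∀ x x', gS x ≠ 0 → f x' ≠ 0 → r ≤ (HiggsLattice.Site.tdist x x' : ℝ) := by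
    intro x x' hx hx'
    have hxS : x ∈ S := by
      by_contra h; exact hx (by simp only [hgS, if_neg h])
    exact hsep x hxS x' hx'
  have hp := pairing_of_coercive C A hk Ω hΩ hmsq hak hγ hlow hδ0 hδ1 hδ gS f hf r hsep'
  rw [← hkey] at hp
  have h1 : siteInner gS gS ≤ 2 / γ * P.mesh k ^ 2 * Real.exp (-(δ * (r / (P.L : ℝ) ^ k))) *
      Real.sqrt (siteInner gS gS) * Real.sqrt (siteInner f f) := (le_abs_self _).trans hp
  exact sqrt_le_of_sq_le (siteInner_self_nonneg gS) (by positivity) (Real.sqrt_nonneg _) h1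

open Classical in
/-- **Restricted bond norm of `D^ε_AG^ε_k(Ω,A)f` with decay**: for a bond set `S` inside `Ω` at lattice distance `≥ r` (from the bonds'
sources) from `supp f`, `‖1_SD^ε_AG^ε_k(Ω,A)f‖ ≤ (2/√γ + 4√d·δ/γ)(L^kε)e^{δ}e^{−δr/L^k}‖f‖` (the second pairing with the restricted bond field
itself as test function). [cite: Balaban1983RegularityDecay, Cor. 2.3 (2.30) p.580] -/
theorem restricted_norm_DG_le (hk : k ≤ P.K) (Ω : Finset (HiggsLattice.Site P 0))
    (hΩ : ∀ x x' : HiggsLattice.Site P 0, blockIter k x = blockIter k x' → (x ∈ Ω ↔ x' ∈ Ω))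
    (hmsq : 0 < msq) (hak : 0 ≤ B1.aSeq a P.L k) {γ : ℝ} (hγ : 0 < γ)
    (hlow : ∀ w : ScalarField P 0 N, (∀ x, x ∉ Ω → w x = 0) →
      γ * ((P.mesh k)⁻¹ ^ 2) * siteInner w w ≤ siteInner w (covOpK C Ω A msq a k w))
    {δ : ℝ} (hδ0 : 0 ≤ δ) (hδ1 : δ ≤ 1) (hδ : 2 * (2 * P.d * δ ^ 2 + B1.aSeq a P.L k * (2 * δ)) ≤ γ)
    (S : Finset (HiggsLattice.PBond P 0)) (hS : ∀ b ∈ S, Inside Ω b) (f : ScalarField P 0 N) (r : ℝ)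
    (hsep : ∀ b ∈ S, ∀ x', f x' ≠ 0 → r ≤ (HiggsLattice.Site.tdist b.src x' : ℝ)) :
    Real.sqrt (bondInner (fun b => if b ∈ S then covDeriv C A (propagatorK C Ω A msq a k f) b else 0)
        (fun b => if b ∈ S then covDeriv C A (propagatorK C Ω A msq a k f) b else 0))
      ≤ (2 / Real.sqrt γ + 4 * Real.sqrt P.d * δ / γ) * P.mesh k * Real.exp δ *
          Real.exp (-(δ * (r / (P.L : ℝ) ^ k))) * Real.sqrt (siteInner f f) := by
  classical
  have hmd : 0 < P.mesh 0 ^ P.d := pow_pos (P.mesh_pos 0) _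
  set hS' : HiggsLattice.PBond P 0 → E N := fun b => if b ∈ S then covDeriv C A (propagatorK C Ω A msq a k f) b else 0
    with hhS
  have hkey : bondInner hS' hS' = bondInner hS' (covDeriv C A (propagatorK C Ω A msq a k f)) := by
    unfold bondInner
    refine Finset.sum_congr rfl fun b _ => ?_
    by_cases hb : b ∈ S
    · simp only [hhS, if_pos hb]
    · simp only [hhS, if_neg hb, inner_zero_left]
  have hh : ∀ b, ¬ Inside Ω b → hS' b = 0 := by
    intro b hb
    have : b ∉ S := fun h => hb (hS b h)
    simp only [hhS, if_neg this]
  have hsep' : ∀ (b : HiggsLattice.PBond P 0) (x' : HiggsLattice.Site P 0), hS' b ≠ 0 → f x' ≠ 0 →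
      r ≤ (HiggsLattice.Site.tdist b.src x' : ℝ) := by
    intro b x' hb hx'
    have hbS : b ∈ S := by
      by_contra h; exact hb (by simp only [hhS, if_neg h])
    exact hsep b hbS x' hx'
  have hp := pairing_DG_of_coercive_any C A hk Ω hΩ hmsq hak hγ hlow hδ0 hδ1 hδ hS' hh f r hsep'
  rw [← hkey] at hp
  have h0 : 0 ≤ bondInner hS' hS' := by
    unfold bondInner; exact Finset.sum_nonneg fun b _ => mul_nonneg hmd.le real_inner_self_nonneg
  have h1 : bondInner hS' hS' ≤ (2 / Real.sqrt γ + 4 * Real.sqrt P.d * δ / γ) * P.mesh k * Real.exp δ *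
      Real.exp (-(δ * (r / (P.L : ℝ) ^ k))) * Real.sqrt (bondInner hS' hS') * Real.sqrt (siteInner f f) :=
    (le_abs_self _).trans hp
  have hK : 0 ≤ (2 / Real.sqrt γ + 4 * Real.sqrt P.d * δ / γ) * P.mesh k * Real.exp δ *
      Real.exp (-(δ * (r / (P.L : ℝ) ^ k))) := by
    have := P.mesh_pos k; positivity
  exact sqrt_le_of_sq_le h0 hK (Real.sqrt_nonneg _) h1

end Restricted

/-! ## §5 (v1.1, append-only) The assembled bound for `⟨f, δG^ε_k(Ω,Ω₀,A)f′⟩` from a coercivity constant and an adapted cutoff -/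

section Assembly

variable (C : ChargeData N) (A : HiggsLattice.VecField P 0) {msq a : ℝ}

open Classical in
/-- Cauchy–Schwarz over a bond set against the source values: `Σ_{b∈S} ε^d‖X(b)‖‖w(b₋)‖ ≤ ‖1_SX‖·(√d·‖1_Tw‖)` for `src(S) ⊂ T`. [folklore] -/
private theorem sum_bond_le (S : Finset (HiggsLattice.PBond P 0)) (T : Finset (HiggsLattice.Site P 0))
    (hST : ∀ b ∈ S, b.src ∈ T) (X : HiggsLattice.PBond P 0 → E N) (w : ScalarField P 0 N) :
    ∑ b ∈ S, P.mesh 0 ^ P.d * (‖X b‖ * ‖w b.src‖)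
      ≤ Real.sqrt (bondInner (fun b => if b ∈ S then X b else 0) (fun b => if b ∈ S then X b else 0))
        * (Real.sqrt P.d * Real.sqrt (siteInner (fun x => if x ∈ T then w x else 0) (fun x => if x ∈ T then w x else 0))) := by
  have hmd : 0 ≤ P.mesh 0 ^ P.d := pow_nonneg (P.mesh_pos 0).le _
  set XS : HiggsLattice.PBond P 0 → ℝ := fun b => if b ∈ S then ‖X b‖ else 0 with hXS
  set wT : ScalarField P 0 N := fun x => if x ∈ T then w x else 0 with hwT
  have h1 : ∑ b ∈ S, P.mesh 0 ^ P.d * (‖X b‖ * ‖w b.src‖) ≤ ∑ b : HiggsLattice.PBond P 0, P.mesh 0 ^ P.d * (XS b * ‖wT b.src‖) := by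
    have hz : ∀ b ∈ (Finset.univ : Finset (HiggsLattice.PBond P 0)), b ∉ S → P.mesh 0 ^ P.d * (XS b * ‖wT b.src‖) = 0 := by
      intro b _ hb
      simp only [hXS, if_neg hb, zero_mul, mul_zero]
    rw [← Finset.sum_subset (Finset.subset_univ S) hz]
    refine Finset.sum_le_sum fun b hb => le_of_eq ?_
    simp only [hXS, hwT, if_pos hb, if_pos (hST b hb)]
  have hcs := Finset.sum_mul_sq_le_sq_mul_sq (Finset.univ : Finset (HiggsLattice.PBond P 0)) XS (fun b => ‖wT b.src‖)
  have h2 : ∑ b : HiggsLattice.PBond P 0, P.mesh 0 ^ P.d * (XS b * ‖wT b.src‖)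
      ≤ Real.sqrt (∑ b : HiggsLattice.PBond P 0, P.mesh 0 ^ P.d * XS b ^ 2)
        * Real.sqrt (∑ b : HiggsLattice.PBond P 0, P.mesh 0 ^ P.d * ‖wT b.src‖ ^ 2) := by
    have hA : |∑ b : HiggsLattice.PBond P 0, XS b * ‖wT b.src‖|
        ≤ Real.sqrt ((∑ b : HiggsLattice.PBond P 0, XS b ^ 2) * ∑ b : HiggsLattice.PBond P 0, ‖wT b.src‖ ^ 2) := Real.abs_le_sqrt hcs
    rw [Real.sqrt_mul (Finset.sum_nonneg fun b _ => sq_nonneg _)] at hA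
    have hB := (le_abs_self _).trans hA
    rw [← Finset.mul_sum, ← Finset.mul_sum, ← Finset.mul_sum, Real.sqrt_mul hmd, Real.sqrt_mul hmd]
    have hsc : Real.sqrt (P.mesh 0 ^ P.d) * Real.sqrt (P.mesh 0 ^ P.d) = P.mesh 0 ^ P.d := Real.mul_self_sqrt hmd
    calc P.mesh 0 ^ P.d * ∑ b : HiggsLattice.PBond P 0, XS b * ‖wT b.src‖
        ≤ P.mesh 0 ^ P.d * (Real.sqrt (∑ b : HiggsLattice.PBond P 0, XS b ^ 2) * Real.sqrt (∑ b : HiggsLattice.PBond P 0, ‖wT b.src‖ ^ 2)) :=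
          mul_le_mul_of_nonneg_left hB hmd
      _ = (Real.sqrt (P.mesh 0 ^ P.d) * Real.sqrt (P.mesh 0 ^ P.d)) *
            (Real.sqrt (∑ b : HiggsLattice.PBond P 0, XS b ^ 2) * Real.sqrt (∑ b : HiggsLattice.PBond P 0, ‖wT b.src‖ ^ 2)) := by rw [hsc]
      _ = _ := by ring
  have e1 : ∑ b : HiggsLattice.PBond P 0, P.mesh 0 ^ P.d * XS b ^ 2
      = bondInner (fun b => if b ∈ S then X b else 0) (fun b => if b ∈ S then X b else 0) := by
    unfold bondInner
    refine Finset.sum_congr rfl fun b _ => ?_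
    by_cases hb : b ∈ S
    · simp only [hXS, if_pos hb, real_inner_self_eq_norm_sq]
    · simp only [hXS, if_neg hb, inner_zero_left, mul_zero]
      ring
  have e2 : ∑ b : HiggsLattice.PBond P 0, P.mesh 0 ^ P.d * ‖wT b.src‖ ^ 2 = P.d * siteInner wT wT := sum_bond_src_sq wT
  rw [e1, e2, Real.sqrt_mul (Nat.cast_nonneg _)] at h2
  exact h1.trans h2

/-- `‖(1 − χ)f‖ ≤ ‖f‖` for `0 ≤ χ ≤ 1`. [folklore] -/
private theorem sqrt_siteInner_oneSub_le (χ : HiggsLattice.Site P 0 → ℝ) (hχ0 : ∀ x, 0 ≤ χ x) (hχ1 : ∀ x, χ x ≤ 1)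
    (f : ScalarField P 0 N) :
    Real.sqrt (siteInner (fun x => (1 - χ x) • f x) (fun x => (1 - χ x) • f x)) ≤ Real.sqrt (siteInner f f) := by
  refine Real.sqrt_le_sqrt ?_
  unfold siteInner
  refine Finset.sum_le_sum fun x _ => mul_le_mul_of_nonneg_left ?_ (pow_nonneg (P.mesh_pos 0).le _)
  rw [real_inner_smul_left, real_inner_smul_right, real_inner_self_eq_norm_sq]
  have h0 : 0 ≤ 1 - χ x := by linarith [hχ1 x]
  have h1 : 1 - χ x ≤ 1 := by linarith [hχ0 x]
  have hn : 0 ≤ ‖f x‖ ^ 2 := sq_nonneg _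
  calc (1 - χ x) * ((1 - χ x) * ‖f x‖ ^ 2) ≤ 1 * (1 * ‖f x‖ ^ 2) := by
        exact mul_le_mul h1 (mul_le_mul_of_nonneg_right h1 hn) (by positivity) zero_le_one
    _ = ‖f x‖ ^ 2 := by ring

/-- if a pairing `Σ_x ε^d⟪(1 − χ(x))·f(x), g(x)⟫` is nonzero then `(1 − χ(x))f(x) ≠ 0` for some `x`. [folklore] -/
private theorem exists_of_siteInner_ne_zero (φ g : ScalarField P 0 N) (h : siteInner φ g ≠ 0) : ∃ x, φ x ≠ 0 := by
  by_contra hne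
  apply h
  unfold siteInner
  refine Finset.sum_eq_zero fun x _ => ?_
  have hx : φ x = 0 := by
    by_contra hx
    exact hne ⟨x, hx⟩
  rw [hx, inner_zero_left, mul_zero]

set_option maxHeartbeats 1600000 in
/-- **THE `δG_k(Ω,Ω₀,A)` PAIRING BOUND FROM A COERCIVITY CONSTANT AND AN ADAPTED CUTOFF** ([13] (1.11) / (2.30) second sentence, `L²`
version, on the concrete carrier).  Data: `Ω ⊆ Ω₀` unions of `k`-blocks; coercivity `γ` of (2.20) at `A` on the `Ω`- and on the `Ω₀`-supported
fields; admissible `δ`; a cutoff `χ` with `0 ≤ χ ≤ 1`, vanishing at both ends of the bonds of `Ω₀` not inside `Ω`, `|χ(b₊) − χ(b₋)| ≤ κ` on every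
bond, block oscillation `≤ κ′` and `χ` constant on the blocks outside `Y`; a bond set `S` inside `Ω` containing the bonds of `Ω` where `χ` jumps; a
site set `T ⊇ {x ∈ Ω : χ(x) ≠ 1} ∪ src(S) ∪ B^k(Y)` (the transition set); `f, f′` supported in `Ω` at lattice distance `≥ r`, `≥ r′` from `T`.
Then `|⟨f, (G^ε_k(Ω,A) − G^ε_k(Ω₀,A))f′⟩| ≤ [4/γ + κε^{−1}(L^kε)·2√d·c_D(2/γ)e^{δ} + 2κ′a_k(2/γ)²]·(L^kε)²·e^{−δr/L^k}e^{−δr′/L^k}‖f‖‖f′‖`,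
`c_D = 2/√γ + 4√d·δ/γ` (with `κ = 1/(ML^k)` the middle constant is `2√d·c_D(2/γ)e^{δ}/M` — uniform in `k`).  Route: `⟨f, δGf′⟩ =
⟨f, G_Ω((1−χ)f′)⟩ − ⟨G_Ωf, E⟩ − ⟨(1−χ)f, G_Ω₀f′⟩` with `E = H_Ω(χu₀) − χf′` = the §2 + §3 commutators (mass terms cancel), every factor a §4
restricted norm; the two boundary terms vanish unless `r′ ≤ 0` resp. `r ≤ 0`. [cite: Balaban1983RegularityDecay, (1.11) p.573, Cor. 2.3 (2.30) p.580] -/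
theorem deltaG_pairing_of_cutoff (hk : k ≤ P.K) (Ω Ω₀ : Finset (HiggsLattice.Site P 0))
    (hΩ : ∀ x x' : HiggsLattice.Site P 0, blockIter k x = blockIter k x' → (x ∈ Ω ↔ x' ∈ Ω))
    (hΩ₀ : ∀ x x' : HiggsLattice.Site P 0, blockIter k x = blockIter k x' → (x ∈ Ω₀ ↔ x' ∈ Ω₀)) (hsub : Ω ⊆ Ω₀)
    (hmsq : 0 < msq) (hak : 0 ≤ B1.aSeq a P.L k) {γ : ℝ} (hγ : 0 < γ)
    (hlow : ∀ w : ScalarField P 0 N, (∀ x, x ∉ Ω → w x = 0) →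
      γ * ((P.mesh k)⁻¹ ^ 2) * siteInner w w ≤ siteInner w (covOpK C Ω A msq a k w))
    (hlow₀ : ∀ w : ScalarField P 0 N, (∀ x, x ∉ Ω₀ → w x = 0) →
      γ * ((P.mesh k)⁻¹ ^ 2) * siteInner w w ≤ siteInner w (covOpK C Ω₀ A msq a k w))
    {δ : ℝ} (hδ0 : 0 ≤ δ) (hδ1 : δ ≤ 1) (hδ : 2 * (2 * P.d * δ ^ 2 + B1.aSeq a P.L k * (2 * δ)) ≤ γ)
    (χ : HiggsLattice.Site P 0 → ℝ) (hχ0 : ∀ x, 0 ≤ χ x) (hχ1 : ∀ x, χ x ≤ 1)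
    (hχbd : ∀ b : HiggsLattice.PBond P 0, Inside Ω₀ b → ¬ Inside Ω b → χ b.src = 0 ∧ χ b.tgt = 0)
    {κ : ℝ} (hκ0 : 0 ≤ κ) (hκ : ∀ b : HiggsLattice.PBond P 0, |χ b.tgt - χ b.src| ≤ κ)
    (S : Finset (HiggsLattice.PBond P 0)) (hSin : ∀ b ∈ S, Inside Ω b) (hS : ∀ b, Inside Ω b → χ b.tgt ≠ χ b.src → b ∈ S)
    {κ' : ℝ} (hκ'0 : 0 ≤ κ') (hosc : ∀ x x' : HiggsLattice.Site P 0, blockIter k x = blockIter k x' → |χ x - χ x'| ≤ κ')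
    (Y : Finset (HiggsLattice.Site P k))
    (hY : ∀ x x' : HiggsLattice.Site P 0, blockIter k x = blockIter k x' → blockIter k x ∉ Y → χ x = χ x')
    (T : Finset (HiggsLattice.Site P 0)) (hTχ : ∀ x, x ∈ Ω → χ x ≠ 1 → x ∈ T) (hTS : ∀ b ∈ S, b.src ∈ T)
    (hTY : ∀ x, blockIter k x ∈ Y → x ∈ T)
    (f f' : ScalarField P 0 N) (hf : ∀ x, x ∉ Ω → f x = 0) (hf' : ∀ x, x ∉ Ω → f' x = 0) (r r' : ℝ)
    (hr : ∀ x t, f x ≠ 0 → t ∈ T → r ≤ (HiggsLattice.Site.tdist x t : ℝ))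
    (hr' : ∀ x t, f' x ≠ 0 → t ∈ T → r' ≤ (HiggsLattice.Site.tdist x t : ℝ)) :
    |siteInner f (propagatorK C Ω A msq a k f') - siteInner f (propagatorK C Ω₀ A msq a k f')|
      ≤ (4 / γ + κ * (P.mesh 0)⁻¹ * P.mesh k * (2 * Real.sqrt P.d * (2 / Real.sqrt γ + 4 * Real.sqrt P.d * δ / γ) * (2 / γ) * Real.exp δ)
            + 2 * κ' * B1.aSeq a P.L k * (2 / γ) ^ 2)
        * P.mesh k ^ 2 * Real.exp (-(δ * (r / (P.L : ℝ) ^ k))) * Real.exp (-(δ * (r' / (P.L : ℝ) ^ k)))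
        * Real.sqrt (siteInner f f) * Real.sqrt (siteInner f' f') := by
  classical
  have hM : 0 < P.mesh k := P.mesh_pos k
  have hm0 : 0 < P.mesh 0 := P.mesh_pos 0
  have hLk : (1 : ℝ) ≤ (P.L : ℝ) ^ k := by exact_mod_cast Nat.one_le_pow _ _ P.hL
  have hLpos : (0 : ℝ) < (P.L : ℝ) ^ k := by linarith
  have hf'₀ : ∀ x, x ∉ Ω₀ → f' x = 0 := fun x hx => hf' x (fun h => hx (hsub h))
  -- abbreviations (plain `have … = …` equations avoided: we keep the explicit terms)
  have hMi : 0 < (P.mesh k)⁻¹ ^ 2 := by positivity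
  set cD := 2 / Real.sqrt γ + 4 * Real.sqrt P.d * δ / γ with hcD
  have hcD0 : 0 ≤ cD := by positivity
  set ef := Real.exp (-(δ * (r / (P.L : ℝ) ^ k))) with hef
  set ef' := Real.exp (-(δ * (r' / (P.L : ℝ) ^ k))) with hef'
  have hef0 : 0 < ef := Real.exp_pos _
  have hef'0 : 0 < ef' := Real.exp_pos _
  set nf := Real.sqrt (siteInner f f) with hnf
  set nf' := Real.sqrt (siteInner f' f') with hnf'
  have hnf0 : 0 ≤ nf := Real.sqrt_nonneg _
  have hnf'0 : 0 ≤ nf' := Real.sqrt_nonneg _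
  set u₀ : ScalarField P 0 N := propagatorK C Ω₀ A msq a k f' with hu₀
  set v : ScalarField P 0 N := propagatorK C Ω A msq a k f with hv
  set E : ScalarField P 0 N := covOpK C Ω A msq a k (fun x => χ x • u₀ x) - fun x => χ x • f' x with hE
  ---------------------------------------------------------------- (a) the algebraic split
  have h1 : (fun x => χ x • u₀ x) = propagatorK C Ω A msq a k (fun x => χ x • f' x) + propagatorK C Ω A msq a k E := by
    have hGH := propagatorK_covOpK_apply C Ω A hmsq a k hak (fun x => χ x • u₀ x)
    rw [hE, map_sub, hGH]
    abel
  have hB_eq : siteInner f (propagatorK C Ω A msq a k (fun x => (1 - χ x) • f' x))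
      = siteInner f (propagatorK C Ω A msq a k f') - siteInner f (propagatorK C Ω A msq a k (fun x => χ x • f' x)) := by
    rw [← siteInner_sub_right, ← map_sub]
    congr 1; congr 1; funext x; simp only [Pi.sub_apply, sub_smul, one_smul]
  have hE_eq : siteInner v E = siteInner f (fun x => χ x • u₀ x) - siteInner f (propagatorK C Ω A msq a k (fun x => χ x • f' x)) := by
    have h2 : siteInner v E = siteInner f (propagatorK C Ω A msq a k E) := by
      rw [hv, siteInner_propagatorK_comm C Ω A msq a k, siteInner_comm]
    rw [h2, ← siteInner_sub_right]
    congr 1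
    rw [h1]; abel
  have hA_eq : siteInner (fun x => (1 - χ x) • f x) u₀ = siteInner f u₀ - siteInner f (fun x => χ x • u₀ x) := by
    rw [← siteInner_smulFun_comm, ← siteInner_sub_right]
    congr 1; funext x; simp only [Pi.sub_apply, sub_smul, one_smul]
  have hsplit : siteInner f (propagatorK C Ω A msq a k f') - siteInner f u₀
      = siteInner f (propagatorK C Ω A msq a k (fun x => (1 - χ x) • f' x)) - siteInner v E
        - siteInner (fun x => (1 - χ x) • f x) u₀ := by
    rw [hB_eq, hE_eq, hA_eq]; ring
  ---------------------------------------------------------------- (b) ⟨v, E⟩ = Laplacian commutator + P_k commutator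
  have hvE : siteInner v E
      = (siteInner v (covLaplacianN C Ω A (fun x => χ x • u₀ x)) - siteInner (fun x => χ x • v x) (covLaplacianN C Ω₀ A u₀))
        + B1.aSeq a P.L k * ((P.mesh k)⁻¹ ^ 2) *
          (siteInner v (projPk C A k (fun x => χ x • u₀ x)) - siteInner (fun x => χ x • v x) (projPk C A k u₀)) := by
    have hHu₀ : covOpK C Ω₀ A msq a k u₀ = f' := covOpK_propagatorK_apply C Ω₀ A hmsq a k hak f'
    have hexp : ∀ (Ω' : Finset (HiggsLattice.Site P 0)) (φ ψ : ScalarField P 0 N), siteInner φ (covOpK C Ω' A msq a k ψ)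
        = siteInner φ (covLaplacianN C Ω' A ψ) + msq * siteInner φ ψ
          + B1.aSeq a P.L k * ((P.mesh k)⁻¹ ^ 2) * siteInner φ (projPk C A k ψ) := by
      intro Ω' φ ψ
      rw [covOpK, LinearMap.add_apply, LinearMap.add_apply, LinearMap.smul_apply, LinearMap.smul_apply,
        LinearMap.id_apply, siteInner_add_right, siteInner_add_right, siteInner_smul_right, siteInner_smul_right]
    have hm1 : siteInner v (fun x => χ x • f' x) = siteInner (fun x => χ x • v x) (covOpK C Ω₀ A msq a k u₀) := by
      rw [hHu₀, siteInner_smulFun_comm]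
    have hm2 : siteInner v (fun x => χ x • u₀ x) = siteInner (fun x => χ x • v x) u₀ := siteInner_smulFun_comm χ v u₀
    rw [hE, siteInner_sub_right, hm1, hexp, hexp, hm2]
    ring
  ---------------------------------------------------------------- (c) the restricted norms
  -- separations in the shapes the §4 lemmas want
  have hsepS : ∀ b ∈ S, ∀ x', f x' ≠ 0 → r ≤ (HiggsLattice.Site.tdist b.src x' : ℝ) := by
    intro b hb x' hx'
    have h := hr x' b.src hx' (hTS b hb)
    rwa [tdist_comm] at h
  have hsepS' : ∀ b ∈ S, ∀ x', f' x' ≠ 0 → r' ≤ (HiggsLattice.Site.tdist b.src x' : ℝ) := by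
    intro b hb x' hx'
    have h := hr' x' b.src hx' (hTS b hb)
    rwa [tdist_comm] at h
  have hsepT : ∀ x ∈ T, ∀ x', f x' ≠ 0 → r ≤ (HiggsLattice.Site.tdist x x' : ℝ) := by
    intro x hx x' hx'
    have h := hr x' x hx' hx
    rwa [tdist_comm] at h
  have hsepT' : ∀ x ∈ T, ∀ x', f' x' ≠ 0 → r' ≤ (HiggsLattice.Site.tdist x x' : ℝ) := by
    intro x hx x' hx'
    have h := hr' x' x hx' hx
    rwa [tdist_comm] at h
  set SY : Finset (HiggsLattice.Site P 0) := Finset.univ.filter fun x => blockIter k x ∈ Y with hSY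
  have hsepY : ∀ x ∈ SY, ∀ x', f x' ≠ 0 → r ≤ (HiggsLattice.Site.tdist x x' : ℝ) := by
    intro x hx x' hx'
    exact hsepT x (hTY x (Finset.mem_filter.1 hx).2) x' hx'
  have hsepY' : ∀ x ∈ SY, ∀ x', f' x' ≠ 0 → r' ≤ (HiggsLattice.Site.tdist x x' : ℝ) := by
    intro x hx x' hx'
    exact hsepT' x (hTY x (Finset.mem_filter.1 hx).2) x' hx'
  have hSin₀ : ∀ b ∈ S, Inside Ω₀ b := fun b hb => ⟨hsub (hSin b hb).1, hsub (hSin b hb).2⟩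
  -- the six restricted norms
  have nDv := restricted_norm_DG_le C A hk Ω hΩ hmsq hak hγ hlow hδ0 hδ1 hδ S hSin f r hsepS
  have nDu := restricted_norm_DG_le C A hk Ω₀ hΩ₀ hmsq hak hγ hlow₀ hδ0 hδ1 hδ S hSin₀ f' r' hsepS'
  have nTv := restricted_norm_G_le C A hk Ω hΩ hmsq hak hγ hlow hδ0 hδ1 hδ T f hf r hsepT
  have nTu := restricted_norm_G_le C A hk Ω₀ hΩ₀ hmsq hak hγ hlow₀ hδ0 hδ1 hδ T f' hf'₀ r' hsepT'
  have nYv := restricted_norm_G_le C A hk Ω hΩ hmsq hak hγ hlow hδ0 hδ1 hδ SY f hf r hsepY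
  have nYu := restricted_norm_G_le C A hk Ω₀ hΩ₀ hmsq hak hγ hlow₀ hδ0 hδ1 hδ SY f' hf'₀ r' hsepY'
  -- fold the names
  rw [← hv] at nDv nTv nYv
  rw [← hu₀] at nDu nTu nYu
  ---------------------------------------------------------------- (d) the Laplacian commutator term
  have hC1 := abs_lap_commutator_le C A Ω Ω₀ hsub χ hχbd hκ0 hκ S hS v u₀
  have hsum1 := sum_bond_le S T hTS (covDeriv C A v) u₀
  have hsum2' := sum_bond_le S T hTS (covDeriv C A u₀) v
  have hsum2 : ∑ b ∈ S, P.mesh 0 ^ P.d * (‖v b.src‖ * ‖covDeriv C A u₀ b‖)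
      ≤ Real.sqrt (bondInner (fun b => if b ∈ S then covDeriv C A u₀ b else 0) (fun b => if b ∈ S then covDeriv C A u₀ b else 0))
        * (Real.sqrt P.d * Real.sqrt (siteInner (fun x => if x ∈ T then v x else 0) (fun x => if x ∈ T then v x else 0))) := by
    refine le_trans (le_of_eq (Finset.sum_congr rfl fun b _ => by rw [mul_comm ‖v b.src‖])) hsum2'
  have hsplit_sum : ∑ b ∈ S, P.mesh 0 ^ P.d * (‖covDeriv C A v b‖ * ‖u₀ b.src‖ + ‖v b.src‖ * ‖covDeriv C A u₀ b‖)
      = ∑ b ∈ S, P.mesh 0 ^ P.d * (‖covDeriv C A v b‖ * ‖u₀ b.src‖) + ∑ b ∈ S, P.mesh 0 ^ P.d * (‖v b.src‖ * ‖covDeriv C A u₀ b‖) := by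
    rw [← Finset.sum_add_distrib]; exact Finset.sum_congr rfl fun b _ => by ring
  have hd0 : 0 ≤ Real.sqrt (P.d : ℝ) := Real.sqrt_nonneg _
  have hlap : |siteInner v (covLaplacianN C Ω A (fun x => χ x • u₀ x)) - siteInner (fun x => χ x • v x) (covLaplacianN C Ω₀ A u₀)|
      ≤ κ * (P.mesh 0)⁻¹ * (2 * Real.sqrt P.d * cD * (2 / γ) * Real.exp δ * P.mesh k ^ 3 * ef * ef' * nf * nf') := by
    refine hC1.trans ?_
    rw [hsplit_sum]
    refine mul_le_mul_of_nonneg_left ?_ (by positivity)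
    have t1 : ∑ b ∈ S, P.mesh 0 ^ P.d * (‖covDeriv C A v b‖ * ‖u₀ b.src‖)
        ≤ (cD * P.mesh k * Real.exp δ * ef * nf) * (Real.sqrt P.d * (2 / γ * P.mesh k ^ 2 * ef' * nf')) := by
      refine hsum1.trans (mul_le_mul nDv (mul_le_mul_of_nonneg_left nTu hd0) (by positivity) (by positivity))
    have t2 : ∑ b ∈ S, P.mesh 0 ^ P.d * (‖v b.src‖ * ‖covDeriv C A u₀ b‖)
        ≤ (cD * P.mesh k * Real.exp δ * ef' * nf') * (Real.sqrt P.d * (2 / γ * P.mesh k ^ 2 * ef * nf)) := by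
      refine hsum2.trans (mul_le_mul nDu (mul_le_mul_of_nonneg_left nTv hd0) (by positivity) (by positivity))
    calc _ ≤ _ := add_le_add t1 t2
      _ = 2 * Real.sqrt P.d * cD * (2 / γ) * Real.exp δ * P.mesh k ^ 3 * ef * ef' * nf * nf' := by ring
  ---------------------------------------------------------------- (e) the P_k commutator term
  have hC2 := projPk_commutator_le C A hk χ hκ'0 hosc Y hY v u₀
  have hYeq : ∀ w : ScalarField P 0 N, (fun x => if blockIter k x ∈ Y then w x else 0) = fun x => if x ∈ SY then w x else 0 := by
    intro w; funext x
    simp only [hSY, Finset.mem_filter, Finset.mem_univ, true_and]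
  rw [hYeq v, hYeq u₀] at hC2
  have hproj : |siteInner v (projPk C A k (fun x => χ x • u₀ x)) - siteInner (fun x => χ x • v x) (projPk C A k u₀)|
      ≤ 2 * κ' * ((2 / γ * P.mesh k ^ 2 * ef * nf) * (2 / γ * P.mesh k ^ 2 * ef' * nf')) := by
    refine hC2.trans ?_
    rw [mul_assoc (2 * κ')]
    exact mul_le_mul_of_nonneg_left (mul_le_mul nYv nYu (Real.sqrt_nonneg _) (by positivity)) (by positivity)
  ---------------------------------------------------------------- (f) the two boundary terms
  have hγK : 0 ≤ 2 / γ * P.mesh k ^ 2 := by positivity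
  -- term A: ⟨(1−χ)f, u₀⟩
  have hA : |siteInner (fun x => (1 - χ x) • f x) u₀| ≤ 2 / γ * P.mesh k ^ 2 * ef * ef' * nf * nf' := by
    by_cases hA0 : siteInner (fun x => (1 - χ x) • f x) u₀ = 0
    · rw [hA0, abs_zero]; positivity
    · obtain ⟨x₁, hx₁⟩ := exists_of_siteInner_ne_zero _ _ hA0
      have hfx₁ : f x₁ ≠ 0 := by intro h; exact hx₁ (by rw [h, smul_zero])
      have hχx₁ : χ x₁ ≠ 1 := by intro h; exact hx₁ (by rw [h, sub_self, zero_smul])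
      have hxΩ : x₁ ∈ Ω := by by_contra h; exact hfx₁ (hf x₁ h)
      have hr_le : r ≤ 0 := by
        have h := hr x₁ x₁ hfx₁ (hTχ x₁ hxΩ hχx₁)
        rw [tdist_self] at h; exact_mod_cast h
      have hef1 : 1 ≤ ef := by
        rw [hef]; apply Real.one_le_exp
        have : δ * (r / (P.L : ℝ) ^ k) ≤ 0 := mul_nonpos_of_nonneg_of_nonpos hδ0 (div_nonpos_of_nonpos_of_nonneg hr_le hLpos.le)
        linarith
      have hsepA : ∀ x x', (fun x => (1 - χ x) • f x) x ≠ 0 → f' x' ≠ 0 → r' ≤ (HiggsLattice.Site.tdist x x' : ℝ) := by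
        intro x x' hx hx'
        have hfx : f x ≠ 0 := by intro h; exact hx (by simp only [h, smul_zero])
        have hχx : χ x ≠ 1 := by intro h; exact hx (by simp only [h, sub_self, zero_smul])
        have hxΩ' : x ∈ Ω := by by_contra h; exact hfx (hf x h)
        exact hsepT' x (hTχ x hxΩ' hχx) x' hx'
      have hp := pairing_of_coercive C A hk Ω₀ hΩ₀ hmsq hak hγ hlow₀ hδ0 hδ1 hδ (fun x => (1 - χ x) • f x) f' hf'₀ r' hsepA
      rw [← hu₀] at hp
      have hn := sqrt_siteInner_oneSub_le χ hχ0 hχ1 f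
      calc _ ≤ _ := hp
        _ ≤ 2 / γ * P.mesh k ^ 2 * ef' * nf * nf' := by
            rw [← hef', ← hnf']
            exact mul_le_mul_of_nonneg_right (mul_le_mul_of_nonneg_left hn (by positivity)) hnf'0
        _ = 1 * (2 / γ * P.mesh k ^ 2 * ef' * nf * nf') := by ring
        _ ≤ ef * (2 / γ * P.mesh k ^ 2 * ef' * nf * nf') := mul_le_mul_of_nonneg_right hef1 (by positivity)
        _ = 2 / γ * P.mesh k ^ 2 * ef * ef' * nf * nf' := by ring
  -- term B: ⟨f, G((1−χ)f′)⟩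
  have hB : |siteInner f (propagatorK C Ω A msq a k (fun x => (1 - χ x) • f' x))| ≤ 2 / γ * P.mesh k ^ 2 * ef * ef' * nf * nf' := by
    by_cases hB0 : (fun x => (1 - χ x) • f' x) = 0
    · rw [hB0, map_zero]
      have : siteInner f (0 : ScalarField P 0 N) = 0 := by
        unfold siteInner; exact Finset.sum_eq_zero fun x _ => by rw [Pi.zero_apply, inner_zero_right, mul_zero]
      rw [this, abs_zero]; positivity
    · obtain ⟨x₁, hx₁⟩ : ∃ x, (fun x => (1 - χ x) • f' x) x ≠ 0 := by
        by_contra hne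
        apply hB0
        funext x
        by_contra hx
        exact hne ⟨x, fun h => hx (by rw [Pi.zero_apply]; exact h)⟩
      have hfx₁ : f' x₁ ≠ 0 := by intro h; exact hx₁ (by simp only [h, smul_zero])
      have hχx₁ : χ x₁ ≠ 1 := by intro h; exact hx₁ (by simp only [h, sub_self, zero_smul])
      have hxΩ : x₁ ∈ Ω := by by_contra h; exact hfx₁ (hf' x₁ h)
      have hr'_le : r' ≤ 0 := by
        have h := hr' x₁ x₁ hfx₁ (hTχ x₁ hxΩ hχx₁)
        rw [tdist_self] at h; exact_mod_cast h
      have hef'1 : 1 ≤ ef' := by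
        rw [hef']; apply Real.one_le_exp
        have : δ * (r' / (P.L : ℝ) ^ k) ≤ 0 := mul_nonpos_of_nonneg_of_nonpos hδ0 (div_nonpos_of_nonpos_of_nonneg hr'_le hLpos.le)
        linarith
      have hsuppB : ∀ x, x ∉ Ω → (fun x => (1 - χ x) • f' x) x = 0 := fun x hx => by simp only [hf' x hx, smul_zero]
      have hsepB : ∀ x x', f x ≠ 0 → (fun x => (1 - χ x) • f' x) x' ≠ 0 → r ≤ (HiggsLattice.Site.tdist x x' : ℝ) := by
        intro x x' hx hx'
        have hfx' : f' x' ≠ 0 := by intro h; exact hx' (by simp only [h, smul_zero])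
        have hχx' : χ x' ≠ 1 := by intro h; exact hx' (by simp only [h, sub_self, zero_smul])
        have hxΩ' : x' ∈ Ω := by by_contra h; exact hfx' (hf' x' h)
        exact hr x x' hx (hTχ x' hxΩ' hχx')
      have hp := pairing_of_coercive C A hk Ω hΩ hmsq hak hγ hlow hδ0 hδ1 hδ f (fun x => (1 - χ x) • f' x) hsuppB r hsepB
      have hn := sqrt_siteInner_oneSub_le χ hχ0 hχ1 f'
      calc _ ≤ _ := hp
        _ ≤ 2 / γ * P.mesh k ^ 2 * ef * nf * nf' := by
            rw [← hef, ← hnf]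
            exact mul_le_mul_of_nonneg_left hn (by positivity)
        _ = 1 * (2 / γ * P.mesh k ^ 2 * ef * nf * nf') := by ring
        _ ≤ ef' * (2 / γ * P.mesh k ^ 2 * ef * nf * nf') := mul_le_mul_of_nonneg_right hef'1 (by positivity)
        _ = 2 / γ * P.mesh k ^ 2 * ef * ef' * nf * nf' := by ring
  ---------------------------------------------------------------- (g) assembly
  rw [hsplit, hvE]
  have hEabs : |(siteInner v (covLaplacianN C Ω A (fun x => χ x • u₀ x)) - siteInner (fun x => χ x • v x) (covLaplacianN C Ω₀ A u₀))
      + B1.aSeq a P.L k * ((P.mesh k)⁻¹ ^ 2) *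
        (siteInner v (projPk C A k (fun x => χ x • u₀ x)) - siteInner (fun x => χ x • v x) (projPk C A k u₀))|
      ≤ κ * (P.mesh 0)⁻¹ * (2 * Real.sqrt P.d * cD * (2 / γ) * Real.exp δ * P.mesh k ^ 3 * ef * ef' * nf * nf')
        + B1.aSeq a P.L k * ((P.mesh k)⁻¹ ^ 2) * (2 * κ' * ((2 / γ * P.mesh k ^ 2 * ef * nf) * (2 / γ * P.mesh k ^ 2 * ef' * nf'))) := by
    refine (abs_add_le _ _).trans (add_le_add hlap ?_)
    rw [abs_mul, abs_of_nonneg (mul_nonneg hak hMi.le)]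
    exact mul_le_mul_of_nonneg_left hproj (mul_nonneg hak hMi.le)
  have hfinal : 2 / γ * P.mesh k ^ 2 * ef * ef' * nf * nf'
      + (κ * (P.mesh 0)⁻¹ * (2 * Real.sqrt P.d * cD * (2 / γ) * Real.exp δ * P.mesh k ^ 3 * ef * ef' * nf * nf')
        + B1.aSeq a P.L k * ((P.mesh k)⁻¹ ^ 2) * (2 * κ' * ((2 / γ * P.mesh k ^ 2 * ef * nf) * (2 / γ * P.mesh k ^ 2 * ef' * nf'))))
      + 2 / γ * P.mesh k ^ 2 * ef * ef' * nf * nf'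
      = (4 / γ + κ * (P.mesh 0)⁻¹ * P.mesh k * (2 * Real.sqrt P.d * cD * (2 / γ) * Real.exp δ)
            + 2 * κ' * B1.aSeq a P.L k * (2 / γ) ^ 2)
        * P.mesh k ^ 2 * ef * ef' * nf * nf' := by
    field_simp
    ring
  calc |siteInner f (propagatorK C Ω A msq a k fun x => (1 - χ x) • f' x)
        - ((siteInner v (covLaplacianN C Ω A (fun x => χ x • u₀ x)) - siteInner (fun x => χ x • v x) (covLaplacianN C Ω₀ A u₀))
          + B1.aSeq a P.L k * ((P.mesh k)⁻¹ ^ 2) *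
            (siteInner v (projPk C A k (fun x => χ x • u₀ x)) - siteInner (fun x => χ x • v x) (projPk C A k u₀)))
        - siteInner (fun x => (1 - χ x) • f x) u₀|
      ≤ |siteInner f (propagatorK C Ω A msq a k fun x => (1 - χ x) • f' x)|
        + |(siteInner v (covLaplacianN C Ω A (fun x => χ x • u₀ x)) - siteInner (fun x => χ x • v x) (covLaplacianN C Ω₀ A u₀))
          + B1.aSeq a P.L k * ((P.mesh k)⁻¹ ^ 2) *
            (siteInner v (projPk C A k (fun x => χ x • u₀ x)) - siteInner (fun x => χ x • v x) (projPk C A k u₀))|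
        + |siteInner (fun x => (1 - χ x) • f x) u₀| := (abs_sub _ _).trans (add_le_add (abs_sub _ _) le_rfl)
    _ ≤ _ := add_le_add (add_le_add hB hEabs) hA
    _ = _ := hfinal

end Assembly

end Literature.MathematicalPhysics.QuantumFieldTheory.Balaban1983to89.B1DeltaGRegularRegion

end
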